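import Mathlib.Data.Fintype.BigOperators
import Mathlib.Algebra.BigOperators.Group.Finset.Sigma
import Mathlib.Algebra.Ring.Int.Units
import Mathlib.Data.Int.Order.Units
import Mathlib.Algebra.Group.End                 -- `MulAut.conj`
import Mathlib.Algebra.Group.Subgroup.Map
import Literature.NumberTheory.Automorphic.Shelstad1982.TransferAndLifting   -- ★ block A: `LiftingSetting` (χ_π, Π_φ, ε(π), lifts), over ★ `Shelstad1979.Correspondences.TemperedSetting`
import Literature.NumberTheory.Automorphic.Shelstad1982.EndoscopicData       -- ★ block B: `centerW` (Z^W), `adSigma` (ad(g₀ × (1 × σ)))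
import HarnessLib

/-!
# Shelstad, *L-indistinguishability for real groups* (1982), §5 — «(5.1) The group `𝕊_{φ}`», «(5.2) An example: the
# L-packets of discrete series representations», «(5.3) Preliminaries», «(5.4) L-packets of tempered representations»:
# DEFINITION 5.0.1, (5.1.1), PROPOSITIONS 5.2.1, 5.2.2, 5.2.4, COROLLARY 5.2.5, LEMMA 5.2.6, (5.2.3), THEOREMS 5.2.7, 5.2.8,
# COROLLARY 5.2.9; PROPOSITIONS 5.3.1–5.3.4, COROLLARY 5.3.10, (5.3.11), (5.3.12), LEMMAS 5.3.13–5.3.15, COROLLARY 5.3.16;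
# LEMMA 5.4.1, PROPOSITIONS 5.4.2, 5.4.3, THEOREM 5.4.4, COROLLARY 5.4.8, PROPOSITION 5.4.9, COROLLARY 5.4.10, PROPOSITIONS
# 5.4.11, 5.4.12, COROLLARY 5.4.13, LEMMAS 5.4.19–5.4.22, COROLLARY 5.4.23, PROPOSITION 5.4.24, (5.4.25), THEOREMS 5.4.26, 5.4.27,
# COROLLARY 5.4.28 — and the finite inversion behind 5.2.8∕5.2.9∕5.4.27∕5.4.28, PROVED

Topic `NumberTheory/Automorphic/Shelstad1982`; namespace `Literature.NumberTheory.Automorphic.Shelstad1982.LPackets`.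
STATEMENTS (a typing carpet, block C of the paper): `structure`s and `def`s with bodies; the only `theorem`s are the three
elementary finite-group identities that print calls «immediate» (the inversion of Theorems 5.2.7∕5.4.26 into 5.2.8∕5.4.27 and the
ghost corollaries 5.2.9∕5.4.28), proved here once over an arbitrary finite group so that the named facts 5.2.8, 5.2.9, 5.4.27, 5.4.28 are
CONSEQUENCES of 5.2.7∕5.4.26 + Lemma 5.2.6∕5.4.21 inside the file.  No `sorry`, no `axiom`, no `instance`, no `notation`.
Source: D. Shelstad, Math. Ann. **259** (1982) 385–430 [Shelstad1982], §5 = pp. 415–430, read on the GDZ page IMAGES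
(PPN235181684_0259, LOG_0060; JPEG per printed page) — the GDZ OCR text drops or garbles every displayed formula, so EVERY display
quoted below is «display read on the page image» (pp. 415–430), never the OCR; page pins are the printed Math. Ann. pages.

## The setting and the dress

Block A (★ `Shelstad1982.TransferAndLifting`) fixed: `G` (real points), an endoscopic group `H` with the §3 data `ξ : ᴸH ↪ ᴸG`, the
admissible transfer factors, and the §4 LIFT `Θ ↦ Lift Θ` dual to `f ↦ f_H` (`LiftingSetting.IsLift`), the tempered irreducible
representations `Rep` with characters `χ_π` (`charOf`), the L-packets `Π_φ` (`packet φ`, `φ ∈ Φ₀(G)` = `SG.Param`), the signs `ε(π)`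
(`eps φ′ π`) of THEOREM 4.1.1 «`χ_{φ′}(f_H) = Σ_{π ∈ Π_φ} ε(π) χ_π(f)` if `φ = ξ∘φ′` is relevant, `0` otherwise» (recalled p. 415).
§5 adds the L-GROUP SIDE of one tempered admissible homomorphism `φ : W → ᴸG`: «`S_φ` the centralizer of `φ(W)` in `ᴸG⁰`, `S_φ⁰` the
connected component of the identity in `S_φ`, `Z^W` the `W`-invariants in the center of `ᴸG⁰`», and «(5.1.1) `𝕊_φ = S_φ ∕ Z^W S_φ⁰`»
(p. 415); `ᴸT⁰`, the Weyl group `Ω(ᴸG⁰, ᴸT⁰)` and its subgroup `Ω_φ` of elements «realized in `S_φ`» (p. 418); the Lie algebras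
`ᴸ𝔤 ⊇ 𝔰_φ ⊇ ᴸ𝔱_φ = {X ∈ ᴸ𝔱 : φ(1 × σ)X = X}` with the root spaces `𝔰_{α^∨}` (pp. 418–419); the group `R_φ` and the exact sequence
(5.3.12) (p. 420); in §5.4 the modified representative `φ̃ = ad s ∘ φ` and `Z_φ` (p. 423).  Mathlib has complex reductive groups only as
abstract groups; so, as in the companion carpets, the file takes
* the complex group `ᴸG⁰` as an abstract group `LG` (a type parameter with `[Group LG]`) and the subgroups `S_φ, S_φ⁰, ᴸT⁰, …`, the
  involution `σ_G` and the element `g₀` of `φ(1 × σ) = g₀ × (1 × σ)` as the fields of the DICTIONARY `SGroupDatum LG Lt` (with the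
  complexified cocharacter space `ᴸ𝔱 = X_*(ᴸT⁰) ⊗ ℂ` as a `ℂ`-module parameter `Lt` carrying `μ, λ`, the lattice `X_*(ᴸT⁰)` and the action
  of `φ(1 × σ)`); `Z^W` and the action of `φ(1 × σ)` on `ᴸG⁰` are block B's ★ `EndoscopicData.centerW` ∕ `adSigma` (DEFINED here as `zW`,
  `phiSigmaAct`, not re-declared); the Weyl group is BUILT as `N(ᴸT⁰)`-elements acting by conjugation, «realized in `S_φ`» is DEFINED
  (`IsRealizedIn`), `S_φ̃ = s S_φ s⁻¹` is DEFINED (`sphiTilde`);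
* the FINITE GROUP `𝕊_φ` as a type parameter `SS` with `[Group SS] [Fintype SS]` presented by a homomorphism `p : S_φ → 𝕊_φ`, (5.1.1)
  becoming the predicate «`p` is onto with kernel `Z^W S_φ⁰`» (`IsSGroupPresentation`) — print's «`𝕊_φ` is abelian and, in fact, a sum
  of groups of order two» (p. 415, COROLLARY 5.4.10) is then a statement ABOUT `SS`, not an assumption on it; likewise `R_φ`, `ℰ(T)^∨`
  are group parameters presented by homomorphisms;
* the PAIRING «`⟨ , ⟩ : 𝕊_{φ} × Π_{φ} → {±1}`» (LEMMA 5.4.20) and the distributions `χ̂_{(φ,𝔵)}` as the fields of the dictionary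
  `PacketPairing L SS` over block A's `LiftingSetting L`; the extended packet `Π̄_φ ⊇ Π_φ` of «ghosts» («some fixed set containing `Π_φ`
  and in 1–1 correspondence with `𝕊_φ^∨` … define the character `χ_π̄` of `π̄` to be the zero distribution», p. 417) is represented by
  the `{±1}`-valued characters `θ` of `𝕊_φ` NOT of the form `⟨·, π⟩`, `π ∈ Π_φ` (`IsGhostCharacter`), so that sums over `Π̄_φ` are sums
  over `Π_φ` (ghost terms vanish) and the ghost rows quantify over such `θ`;
* the Lie-algebra statements (5.3.2, 5.3.4, 5.3.10, 5.3.13, 5.3.15, 5.4.2, 5.4.3) over the dictionary `RootSpaceDatum Lg` (`ᴸ𝔤` a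
  `ℂ`-module parameter; roots, `⟨μ, α^∨⟩`, `φ(1 × σ)` on roots and root vectors, `𝔛_{α^∨}`, `𝔰`, `Q`, `Δ^∨_φ`, Plancherel factors as
  fields).
No dictionary field asserts a proposition.  **Every numbered item is a `def … : Prop` PREDICATE on explicit dictionaries∕binders**
(precedents ★ `Shelstad1979.Correspondences`, ★ `Shelstad1982.TransferAndLifting`): print's theorem = the predicate HOLDS for print's
data; no debt is created.  The three `theorem`s are closed, over arbitrary finite groups, and carry their proofs.

## Index (print item ↦ declaration)

| print | declaration | kind |
|---|---|---|
| DEF 5.0.1 «factors through ∕ lifts to» (p. 415) | `ParamLiftsTo` | def |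
| §5.1 `S_φ, S_φ⁰, Z^W, ᴸT⁰`, §5.3 `Ω_φ`, §5.4 `s, Z(ᴸM⁰)^W, Z_φ` (pp. 415, 418, 423) | `SGroupDatum`, `normLT0`, `zW` (= B's ★ `centerW`), `phiSigmaAct` (= B's ★ `adSigma`), `IsRealizedIn`, `sphiTilde`, `sphi0Tilde` | structure ∕ def |
| (5.1.1) `𝕊_φ = S_φ∕Z^W S_φ⁰` (p. 415) | `IsSGroupPresentation` | def |
| p. 415 «`𝕊_φ` abelian, a sum of groups of order two» = COR 5.4.10 (p. 425) | `Shelstad1982_5_4_10_elementaryTwoGroup` | def (Prop) |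
| PROP 5.2.1 (p. 415), «`η : ℰ(T)^∨ ≅ S_φ ∩ ᴸT⁰∕Z(ᴸM⁰)^W`» (p. 425) | `Shelstad1982_5_2_1_etaIso` | def (Prop) |
| PROP 5.2.2 (p. 416) | `Shelstad1982_5_2_2_conjugateToSH` | def (Prop) |
| §5.2∕§5.4 the pairing `⟨𝔵, π⟩`, `χ̂_{(φ,𝔵)}`, its scalar `ε(T,η) det g κ(g⁻¹)` ∕ `ε(Ψ̄)ε(T̄,η̄) det g κ̄(g⁻¹)` ∕ `c` (pp. 416–417, 428–429) | `PacketPairing`, `pairC`, `IsGhostCharacter` | structure ∕ def |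
| p. 416 display «`ε(π(ω,Ψ)) = ε(T,η) det g κ(g⁻¹) κ^{g⁻¹}(ω)`, `⟨𝔵, π(ω,Ψ)⟩ = κ^{g⁻¹}(ω)`», «`χ̂_{φ′}(f_H) = ε(T,η) det g κ(g⁻¹) χ_{φ′}(f_H)`» ∕ LEMMA 5.4.22 ∕ p. 429 | `Shelstad1982_5_2_epsViaPairing`, `Shelstad1982_5_2_chiHatViaLift` | def (Prop) |
| PROP 5.2.4 (p. 417) ∕ p. 427 «`⟨𝔵, π⟩ = x(ω̄_σ)`» | `Shelstad1982_5_2_4_pairingViaTateNakayama` | def (Prop) |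
| COR 5.2.5 (i)(ii) (p. 417) ∕ LEMMA 5.4.19, LEMMA 5.4.20, COR 5.4.23 (pp. 427–428) | `Shelstad1982_5_2_5_independence` | def (Prop) |
| LEMMA 5.2.6 (i)(ii) (p. 417) = LEMMA 5.4.21 (i)(ii) (p. 427) | `Shelstad1982_5_2_6_i_multiplicative`, `Shelstad1982_5_2_6_ii_separates` | def (Prop) |
| p. 417 ∕ p. 427 «`Π_φ ⊂ 𝕊_φ^∨`, `Π̄_φ` in 1–1 correspondence with `𝕊_φ^∨`» | `Shelstad1982_5_2_packetInDual` | def (Prop) |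
| (5.2.3) + THM 5.2.7 (p. 417) = (5.4.25) + THM 5.4.26 (p. 429) | `Shelstad1982_5_4_26_endoscopicCharacterIdentity` | def (Prop) |
| THM 5.2.8 (p. 417) = THM 5.4.27 (p. 429) | `Shelstad1982_5_4_27_inversion` | def (Prop) |
| COR 5.2.9 (p. 417) = COR 5.4.28 (p. 430) | `Shelstad1982_5_4_28_ghostVanishing` | def (Prop) |
| «The inversion is immediate» (p. 429): 5.4.26 + 5.4.21 ⇒ 5.4.27, ⇒ 5.4.28 | `inversion_of_pairingIdentity`, `ghost_of_pairingIdentity` (+ private `sum_signHom_eq_zero`), `Shelstad1982_5_4_27_holds_of_26`, `Shelstad1982_5_4_28_holds_of_26` | theorem (proved) |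
| PROP 5.3.1 (p. 418) | `Shelstad1982_5_3_1_realizedIff` | def (Prop) |
| §5.3 root-space data `ᴸ𝔱_φ, 𝔛_{α^∨}, 𝔰_{α^∨}, Q, Δ^∨_φ, μ_α̃` (pp. 418–421) | `RootSpaceDatum`, `frakS` | structure ∕ def |
| PROP 5.3.2 (p. 418), PROP 5.3.3 (p. 419) | `Shelstad1982_5_3_2_cartanSubalgebra`, `Shelstad1982_5_3_3_realizedEqAut` | def (Prop) |
| PROP 5.3.4 (5.3.5)–(5.3.9) (p. 419) | `Shelstad1982_5_3_4_rootSpaces` | def (Prop) |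
| COR 5.3.10 (p. 420) | `Shelstad1982_5_3_10_nonzeroAreRootSpaces` | def (Prop) |
| (5.3.11), (5.3.12) (p. 420) | `Shelstad1982_5_3_11_semidirect`, `Shelstad1982_5_3_12_exact` | def (Prop) |
| LEMMA 5.3.13 (i)–(iv) (p. 420) | `Shelstad1982_5_3_13_DeltaPhi` | def (Prop) |
| LEMMA 5.3.14 (p. 421) | `Shelstad1982_5_3_14_restrictedWeyl` | def (Prop) |
| LEMMA 5.3.15 + (5.3.16)–(5.3.18) (pp. 421–422) | `Shelstad1982_5_3_15_rootIffPlancherel`, `Shelstad1982_5_3_16_sigmaOnRootVector` | def (Prop) |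
| COR 5.3.16 (p. 422) | `Shelstad1982_5_3_16_atMostRConstituents` | def (Prop) |
| LEMMA 5.4.1 (p. 422) | `Shelstad1982_5_4_1_centerInvariants` | def (Prop) |
| PROP 5.4.2 (i)(ii), PROP 5.4.3 (i)–(iii) (p. 423) | `Shelstad1982_5_4_2_DeltaPhiInLeviTilde`, `Shelstad1982_5_4_3_phiTilde` | def (Prop) |
| THM 5.4.4 (p. 423), (5.4.5)–(5.4.7) (pp. 423–424) | `Shelstad1982_5_4_4_SGroupViaTorus`, `Shelstad1982_5_4_5_to_7` | def (Prop) |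
| COR 5.4.8 (p. 424), PROP 5.4.12, COR 5.4.13 (p. 425) | `Shelstad1982_5_4_8_RGroupViaTorus`, `Shelstad1982_5_4_12_etaTildeOntoR` | def (Prop) |
| PROP 5.4.9 (p. 425) | `Shelstad1982_5_4_9_etaTildeOnto` | def (Prop) |
| PROP 5.4.11 (p. 425) | `Shelstad1982_5_4_11_exact` | def (Prop) |
| p. 427 «`[Π̄_φ] = [𝔇(T)][R_φ]`, `[𝕊_φ^∨] = [ℰ(T)][R_φ]`» | `Shelstad1982_5_4_packetCount` | def (Prop) |
| PROP 5.4.24 (p. 428) | `Shelstad1982_5_4_24_adaptedData` | def (Prop) |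

Deliberately NOT typed: the constructions inside the proofs (the representative `𝔰(𝔵)`, the 6-tuples of (2.3), `Cent(𝔵)⁰`, the
parameters `(gμ − μ*, λ − λ*)` of `φ′`, pp. 415–416, 427–429 — they enter only as the dictionary fields `phiH`, `hatScalar`); the
standing choices and claims (5.4.14)–(5.4.18) (hypotheses on the representative `φ̄ = φ(μ̄, λ̄)` and the parametrisation of `Π_{φ}` by
the `Θ^G(ω̄μ̄, λ̄, ω̄Ψ̄)`, p. 426 — block A's THEOREM 4.3.2 dress); LEMMA 5.4.22's coherent-continuation proof; COROLLARY 5.4.13's Tate–Nakayama image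
`Ω(M̃,T̃) ∩ Ω(Δ^∨_φ)∕Ω(Δ^∨_φ)` beyond its statement as a predicate on the dictionary.  Dedup: no `[cite: Shelstad1982, §5 …]` statement is
in the tree (the 9 files citing the key cite it bare for the transfer `f ↦ f_H` and Theorem 4.1.1 = block A, or, in ★
`Arthur2013.Downstream8`, for «the works of Shelstad» on archimedean packets); `S_φ`-groups, packets-vs-characters pairings and
R-groups have no carrier in Mathlib or the tree (`lean search 'SGroup|Rgroup|LPacket|componentGroup' --decl`).

## References
* [Shelstad1982] D. Shelstad, *L-indistinguishability for real groups*, Math. Ann. 259 (1982) 385–430, §5 pp. 415–430 (GDZ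
  PPN235181684_0259 ∕ LOG_0060; page images `pNNNN.jpg` = printed page NNNN).
-/

universe u

namespace Literature.NumberTheory.Automorphic.Shelstad1982.LPackets

open Literature.NumberTheory.Automorphic.Shelstad1982.TransferAndLifting
open Literature.NumberTheory.Automorphic.Shelstad1982.EndoscopicData (centerW adSigma)

/-! ## §5.0 — Definition 5.0.1 -/

/-- **DEFINITION 5.0.1 (p. 415).**  «Let `{φ} ∈ Φ₀(G)`. Then `{φ}` *factors through* `{φ_H} ∈ Φ₀(H)` or, equivalently, `{φ_H}` *lifts to*
`{φ}`, if `φ′ = ξ∘φ′_H` for some `φ′ ∈ {φ}`, `φ′_H ∈ {φ_H}`.»  In block A's dictionary the classes are the parameters themselves and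
`ξ^Φ : Φ₀(H) → Φ₀(G*)`, `Φ₀(G) ⊂ Φ₀(G*)` are `xiParam`, `toStar`; so: `{φ_H}` lifts to `{φ}` iff `ξ^Φ{φ_H} = {φ}` in `Φ₀(G*)`.
[cite: Shelstad1982, Def. 5.0.1 (p. 415)] -/
def ParamLiftsTo {G H : Type u} [Group G] [Group H] (L : LiftingSetting G H) (φH : L.SH.Param) (φ : L.SG.Param) : Prop :=
  L.xiParam φH = L.toStar φ

/-! ## §5.1 ∕ §5.3 ∕ §5.4 — the L-group side of one `φ`: the dictionary `SGroupDatum` -/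

/-- **The L-group data of one tempered admissible homomorphism `φ : W → ᴸG`** (data only).  `LG` = the complex group `ᴸG⁰`; `Lt` =
`ᴸ𝔱 = X_*(ᴸT⁰) ⊗ ℂ` (p. 418).  Fields: `Sphi` = «`S_φ` the centralizer of `φ(W)` in `ᴸG⁰`», `Sphi0` = «`S_φ⁰` the connected component of
the identity in `S_φ`» (p. 415); `sigmaG` = the action `σ_G` of `1 × σ ∈ W` on `ᴸG⁰` (pp. 389, 418), so that «`Z^W` the set of
`W`-invariants in the center of `ᴸG⁰`» (p. 415) is block B's ★ `centerW sigmaG` (`zW` below); `phiSigma0` = the `ᴸG⁰`-component `g₀` of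
`φ(1 × σ) = g₀ × (1 × σ)`, so that the action of `φ(1 × σ)` on `ᴸG⁰` («`φ(1 × σ)` … normalizes `ᴸT⁰` and acts on `ᴸT⁰` as `σ̄`», p. 416;
p. 418) is block B's ★ `adSigma sigmaG g₀` (`phiSigmaAct` below); `LT0` = `ᴸT⁰` (p. 415); `nAct n` = the action of `n ∈ N(ᴸT⁰)` on `ᴸ𝔱`,
`sigmaLt` = the action of `φ(1 × σ)` on `ᴸ𝔱`,
`latt` = `X_*(ᴸT⁰) ⊂ ᴸ𝔱`, `mu`, `lam` = the parameters of «`φ = φ(μ, λ)` … defined relative to `ᴸM`» (p. 418); `ZLM0W` = «`Z(ᴸM⁰)^W` the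
set of `W`-invariants in the center of `ᴸM⁰`» (p. 422); `Zphi` = «`Z_φ = {z ∈ Z(ᴸM⁰)^W : α^∨(z) = 1, α^∨ ∈ Δ^∨_φ}`» (p. 423); `sElt` = «`s =
∏ s_{α^∨}`, the products … over positive roots `α^∨` in `Δ^∨_φ`», `s_{α^∨} = exp iπ∕4 (X_{α^∨} + X_{−α^∨})` (p. 423); `kerDeltaPhi` =
«`{t ∈ ᴸT⁰ : α^∨(t) = 1, α^∨ ∈ Δ^∨_φ}`» (COR 5.4.8, p. 424). [cite: Shelstad1982, §5.1 p. 415; §5.3 p. 418; §5.4 pp. 422–424] -/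
structure SGroupDatum (LG Lt : Type u) [Group LG] [AddCommGroup Lt] [Module ℂ Lt] where
  /-- `S_φ` (p. 415). -/
  Sphi : Subgroup LG
  /-- `S_φ⁰` (p. 415). -/
  Sphi0 : Subgroup LG
  /-- `σ_G`, the action of `1 × σ ∈ W` on `ᴸG⁰` (pp. 389, 418). -/
  sigmaG : LG ≃* LG
  /-- `g₀` with `φ(1 × σ) = g₀ × (1 × σ)` (p. 416, p. 418). -/
  phiSigma0 : LG
  /-- `ᴸT⁰` (p. 415). -/
  LT0 : Subgroup LG
  /-- The action of `N(ᴸT⁰)` on `ᴸ𝔱` (p. 418). -/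
  nAct : LG → Lt →ₗ[ℂ] Lt
  /-- The action of `φ(1 × σ)` on `ᴸ𝔱` (p. 418). -/
  sigmaLt : Lt →ₗ[ℂ] Lt
  /-- `X_*(ᴸT⁰) ⊂ ᴸ𝔱` (p. 418). -/
  latt : AddSubgroup Lt
  /-- `μ` of `φ = φ(μ, λ)` (p. 418). -/
  mu : Lt
  /-- `λ` of `φ = φ(μ, λ)` (p. 418). -/
  lam : Lt
  /-- `Z(ᴸM⁰)^W` (p. 422). -/
  ZLM0W : Subgroup LG
  /-- `Z_φ` (p. 423). -/
  Zphi : Subgroup LG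
  /-- `s = ∏ s_{α^∨}` (p. 423). -/
  sElt : LG
  /-- `{t ∈ ᴸT⁰ : α^∨(t) = 1, α^∨ ∈ Δ^∨_φ}` (p. 424). -/
  kerDeltaPhi : Subgroup LG

namespace SGroupDatum

variable {LG Lt : Type u} [Group LG] [AddCommGroup Lt] [Module ℂ Lt] (D : SGroupDatum LG Lt)

/-- `N(ᴸT⁰)`, the normalizer of `ᴸT⁰` in `ᴸG⁰`; its elements represent `Ω(ᴸG⁰, ᴸT⁰) = N(ᴸT⁰)∕ᴸT⁰` (p. 416 «`g ∈ Ω(ᴸG⁰, ᴸT⁰)`», p. 418).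
[cite: Shelstad1982, §5.2 p. 416; §5.3 p. 418] -/
def normLT0 : Subgroup LG :=
  Subgroup.normalizer (D.LT0 : Set LG)

/-- **`Z^W`**, «the set of `W`-invariants in the center of `ᴸG⁰`» (p. 415) = block B's ★ `centerW` at `σ_G`. [cite: Shelstad1982, §5.1 p. 415] -/
noncomputable def zW : Subgroup LG :=
  centerW D.sigmaG

/-- **The action of `φ(1 × σ) = g₀ × (1 × σ)` on `ᴸG⁰`**, `x ↦ g₀ σ_G(x) g₀⁻¹` (pp. 416, 418) = block B's ★ `adSigma σ_G g₀`.
[cite: Shelstad1982, §5.2 p. 416; §5.3 p. 418] -/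
noncomputable def phiSigmaAct : LG ≃* LG :=
  adSigma D.sigmaG D.phiSigma0

/-- **«`ω ∈ Ω(ᴸG⁰, ᴸT⁰)` is realized in `S_φ`»** (p. 418): «if there is `s ∈ S_φ` such that `ω = ad s|ᴸT⁰`»; here for the Weyl element
represented by `n ∈ N(ᴸT⁰)`: some `s ∈ S_φ` induces on `ᴸT⁰` the same conjugation as `n`. [cite: Shelstad1982, §5.3 p. 418] -/
def IsRealizedIn (n : LG) : Prop :=
  ∃ s ∈ D.Sphi, ∀ t ∈ D.LT0, s * t * s⁻¹ = n * t * n⁻¹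

/-- **`S_φ̃`** for «`φ̃ = ad s ∘ φ`» (PROP 5.4.3, p. 423): the centralizer of `φ̃(W)` is `s S_φ s⁻¹`. [cite: Shelstad1982, §5.4 p. 423] -/
def sphiTilde : Subgroup LG :=
  D.Sphi.map (MulAut.conj D.sElt).toMonoidHom

/-- **`S_φ̃⁰ = s S_φ⁰ s⁻¹`** (p. 423). [cite: Shelstad1982, §5.4 p. 423] -/
def sphi0Tilde : Subgroup LG :=
  D.Sphi0.map (MulAut.conj D.sElt).toMonoidHom

/-- **(5.1.1) (p. 415): «`𝕊_φ = S_φ ∕ Z^W S_φ⁰`»**, as a presentation of the finite group `SS` by `p : S_φ → 𝕊_φ`: `p` is onto and its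
kernel is `Z^W S_φ⁰ ∩ S_φ` (so `SS ≅ S_φ∕Z^W S_φ⁰`; «If `𝐆` is simply-connected then `ᴸG⁰` is adjoint, so that `𝕊_φ = S_φ∕S_φ⁰`»).
[cite: Shelstad1982, §5.1 (5.1.1) (p. 415)] -/
def IsSGroupPresentation {SS : Type u} [Group SS] (p : D.Sphi →* SS) : Prop :=
  Function.Surjective p ∧ p.ker = (D.zW ⊔ D.Sphi0).subgroupOf D.Sphi

/-- **p. 415 ∕ COROLLARY 5.4.10 (p. 425).**  «Langlands has shown that `𝕊_φ` is abelian and, in fact, a sum of groups of order two … see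
also Corollary 5.4.10»; COR 5.4.10: «`𝕊_{φ}` is a sum of groups of order two» — for a finite group: commutative of exponent dividing `2`.
[cite: Shelstad1982, §5.1 p. 415; Cor. 5.4.10 (p. 425)] -/
def Shelstad1982_5_4_10_elementaryTwoGroup (SS : Type u) [Group SS] : Prop :=
  (∀ x y : SS, x * y = y * x) ∧ ∀ x : SS, x * x = 1

/-- **PROPOSITION 5.2.1 (p. 415)** (discrete `{φ}`; `T` compact modulo the center, `η` a p.d. of `T`; `ℰ(T)` of [11], a finite abelian
group): «`η` induces an isomorphism between `𝕊_φ` and `ℰ(T)^∨`, the dual of `ℰ(T)`» — for the map `e : 𝕊_φ → ℰ(T)^∨` induced by `η`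
(binder): `e` is a bijective homomorphism.  §5.4 p. 425: «`η` induces an isomorphism `ℰ(T)^∨ → S_φ ∩ ᴸT⁰∕Z(ᴸM⁰)^W`» is the tempered
analogue (PROP 5.4.11's kernel). [cite: Shelstad1982, Prop. 5.2.1 (p. 415); §5.4 p. 425] -/
def Shelstad1982_5_2_1_etaIso {SS ET : Type u} [Group SS] [CommGroup ET] (e : SS →* (ET →* ℂˣ)) : Prop :=
  Function.Bijective e

/-- **PROPOSITION 5.2.2 (p. 416).**  (`𝔵 ∈ 𝕊_{φ}` «is a coset of `Z^W` in `ᴸT⁰`», with attached representative `𝔰(𝔵)`; `𝔰_H = (s_H, ᴸH)`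
the fixed representative equivalent to `𝔰(𝔵)`; «Suppose that `g ∈ ᴸG⁰` and `g` maps `𝔰(𝔵)` to `𝔰_H` in the sense of (2.1)» — the
predicate `mapsTo g x sH`, a binder.)  «`g ∈ Ω(ᴸG⁰, ᴸT⁰)` and `𝔵^g = s_H`» («we argue in `ᴸG⁰∕Z^W`»): `g` normalizes `ᴸT⁰` and `g x g⁻¹ ≡ s_H
mod Z^W`. [cite: Shelstad1982, Prop. 5.2.2 (p. 416)] -/
def Shelstad1982_5_2_2_conjugateToSH (mapsTo : LG → LG → LG → Prop) : Prop :=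
  ∀ (g x sH : LG), x ∈ D.LT0 → mapsTo g x sH →
    g ∈ D.normLT0 ∧ ∃ z ∈ D.zW, g * x * g⁻¹ = z * sH

/-- **PROPOSITION 5.3.1 (p. 418).**  «`ω ∈ Ω(ᴸG⁰, ᴸT⁰)` is realized in `S_φ` if and only if `ω` commutes with the action of `φ(1 × σ)` on
`ᴸT⁰` and `ωμ = μ`, `ωλ ≡ λ mod (X_*(ᴸT⁰) + {v − φ(1 × σ)v : v ∈ X_*(ᴸT⁰) ⊗ ℂ})`», for `ω` represented by `n ∈ N(ᴸT⁰)`.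
[cite: Shelstad1982, Prop. 5.3.1 (p. 418)] -/
def Shelstad1982_5_3_1_realizedIff : Prop :=
  ∀ n ∈ D.normLT0,
    D.IsRealizedIn n ↔
      (∀ t ∈ D.LT0, n * D.phiSigmaAct t * n⁻¹ = D.phiSigmaAct (n * t * n⁻¹)) ∧
        D.nAct n D.mu = D.mu ∧
          ∃ v ∈ D.latt, ∃ w : Lt, D.nAct n D.lam - D.lam = v + (w - D.sigmaLt w)

/-- **(5.3.12) (p. 420): «There is an exact sequence `1 → S_φ ∩ ᴸT⁰∕S_φ⁰ ∩ ᴸT⁰ → S_φ∕S_φ⁰ → R_φ → 1`»**, for `R_φ` presented by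
`r : S_φ → R_φ` (binder): `r` is onto with kernel `S_φ⁰ · (S_φ ∩ ᴸT⁰)` (first-isomorphism form of the sequence).
[cite: Shelstad1982, §5.3 (5.3.12) (p. 420)] -/
def Shelstad1982_5_3_12_exact {RR : Type u} [Group RR] (r : D.Sphi →* RR) : Prop :=
  Function.Surjective r ∧ r.ker = (D.Sphi0 ⊔ (D.Sphi ⊓ D.LT0)).subgroupOf D.Sphi

/-- **LEMMA 5.3.14 (p. 421).**  (`𝒲 = {ω̃ ∈ 𝒲_T : π^ω̃ = π}` ⊂ the restricted Weyl group of `T`, identified with a subgroup of `Ω₀(G,T)`,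
pp. 421.)  «`η` induces an isomorphism between `𝒲` and `Ω_φ(ᴸG⁰, ᴸT⁰)`» — for the map `w ↦ η(w) ∈ N(ᴸT⁰)` (binder `etaN` on the finite
group `𝒲`): every `η(w)` is realized in `S_φ`, every realized class is some `η(w)`, and `η(w), η(w′)` act alike on `ᴸT⁰` only if `w = w′`.
[cite: Shelstad1982, Lemma 5.3.14 (p. 421)] -/
def Shelstad1982_5_3_14_restrictedWeyl {WW : Type u} [Group WW] (etaN : WW → LG) : Prop :=
  (∀ w, etaN w ∈ D.normLT0 ∧ D.IsRealizedIn (etaN w)) ∧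
    (∀ n ∈ D.normLT0, D.IsRealizedIn n → ∃ w, ∀ t ∈ D.LT0, etaN w * t * (etaN w)⁻¹ = n * t * n⁻¹) ∧
      ∀ w w', (∀ t ∈ D.LT0, etaN w * t * (etaN w)⁻¹ = etaN w' * t * (etaN w')⁻¹) → w = w'

/-- **COROLLARY 5.3.16 (p. 422).**  «Each representation `π(ω)` has at most `[R_φ]` constituents» («That `π(ω)` has exactly `[R_φ]`
constituents is, of course, known (cf. [6])» — not asserted).  Binders: the finite group `R_φ`, the number of (irreducible) constituents
`nconst ω` of `π(ω) = Ind(π(ω, Ψ_M) ⊗ 1_N, P, G)`, `ω ∈ Ω(ᴸM⁰, ᴸT⁰)`. [cite: Shelstad1982, Cor. 5.3.16 (p. 422)] -/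
def Shelstad1982_5_3_16_atMostRConstituents {RR ΩM : Type u} [Group RR] [Fintype RR] (nconst : ΩM → ℕ) : Prop :=
  ∀ ω, nconst ω ≤ Fintype.card RR

/-- **LEMMA 5.4.1 (p. 422).**  «`Z(ᴸM⁰)^W = Z^W (S_φ⁰ ∩ ᴸT⁰)`.» [cite: Shelstad1982, Lemma 5.4.1 (p. 422)] -/
def Shelstad1982_5_4_1_centerInvariants : Prop :=
  D.ZLM0W = D.zW ⊔ (D.Sphi0 ⊓ D.LT0)

/-- **THEOREM 5.4.4 (p. 423).**  «`𝕊_φ ≅ S_φ̃ ∩ ᴸT⁰∕Z_φ`» — via «`ad s : S_φ → S_φ̃` induces an isomorphism `𝕊_φ → S_φ̃∕Z_φ S_φ̃⁰`» and (5.4.5):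
typed for the presentation `p : S_φ → 𝕊_φ` as: `Z_φ ≤ S_φ̃ ∩ ᴸT⁰` and there is a group isomorphism `e : 𝕊_φ ≃ (S_φ̃ ∩ ᴸT⁰)∕Z_φ`-presented —
i.e. an onto homomorphism `q : S_φ̃ ∩ ᴸT⁰ → 𝕊_φ` with kernel `Z_φ` such that `q(s y s⁻¹) = p(y)` whenever `y ∈ S_φ` and `s y s⁻¹ ∈ ᴸT⁰`.
[cite: Shelstad1982, Thm. 5.4.4 (p. 423)] -/
def Shelstad1982_5_4_4_SGroupViaTorus {SS : Type u} [Group SS] (p : D.Sphi →* SS) : Prop :=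
  D.Zphi ≤ D.sphiTilde ⊓ D.LT0 ∧
    ∃ q : ↥(D.sphiTilde ⊓ D.LT0) →* SS, Function.Surjective q ∧ q.ker = D.Zphi.subgroupOf (D.sphiTilde ⊓ D.LT0) ∧
      ∀ (y : D.Sphi) (hy : D.sElt * (y : LG) * D.sElt⁻¹ ∈ D.sphiTilde ⊓ D.LT0),
        q ⟨D.sElt * (y : LG) * D.sElt⁻¹, hy⟩ = p y

/-- **(5.4.5)–(5.4.7) (pp. 423–424)**, the three claims of the proof of Theorem 5.4.4: «(5.4.5) `S_φ̃∕S_φ̃⁰` has a complete set of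
representatives in `ᴸT⁰`», «(5.4.6) `S_φ̃⁰ ∩ ᴸT⁰ ⊆ Z_φ`» (with Lemma 5.4.1: «`Z_φ = (S_φ̃⁰ ∩ ᴸT⁰) Z^W`», p. 424), «(5.4.7)
`Ω(Δ^∨_φ) ∩ Ω_φ(ᴸG⁰, ᴸT⁰) = R_φ`» — the last for `Ω(Δ^∨_φ)` given by normalizer representatives `OmegaDelta ⊆ N(ᴸT⁰)` and `R_φ` by the set
`RSet ⊆ N(ᴸT⁰)` of representatives (binders; equality of the induced sets of `ᴸT⁰`-conjugations).
[cite: Shelstad1982, §5.4 (5.4.5)–(5.4.7) (pp. 423–424)] -/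
def Shelstad1982_5_4_5_to_7 (OmegaDelta RSet : Set LG) : Prop :=
  (∀ x ∈ D.sphiTilde, ∃ t ∈ D.LT0, ∃ y ∈ D.sphi0Tilde, x = t * y) ∧
    D.sphi0Tilde ⊓ D.LT0 ≤ D.Zphi ∧ D.Zphi = (D.sphi0Tilde ⊓ D.LT0) ⊔ D.zW ∧
      ∀ n : LG, (∃ m ∈ RSet, ∀ t ∈ D.LT0, m * t * m⁻¹ = n * t * n⁻¹) ↔
        (∃ m ∈ OmegaDelta, ∀ t ∈ D.LT0, m * t * m⁻¹ = n * t * n⁻¹) ∧ n ∈ D.normLT0 ∧ D.IsRealizedIn n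

/-- **COROLLARY 5.4.8 (p. 424).**  «`R_φ ≅ S_φ̃ ∩ ᴸT⁰ ∕ S_φ̃ ∩ {t ∈ ᴸT⁰ : α^∨(t) = 1, α^∨ ∈ Δ^∨_φ}`», for `R_φ` presented by an onto
homomorphism from `S_φ̃ ∩ ᴸT⁰` with that kernel (the map of the proof, «surjective by the argument for (5.4.5)»).
[cite: Shelstad1982, Cor. 5.4.8 (p. 424)] -/
def Shelstad1982_5_4_8_RGroupViaTorus {RR : Type u} [Group RR] (rT : ↥(D.sphiTilde ⊓ D.LT0) →* RR) : Prop :=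
  Function.Surjective rT ∧ rT.ker = (D.sphiTilde ⊓ D.kerDeltaPhi).subgroupOf (D.sphiTilde ⊓ D.LT0)

/-- **PROPOSITION 5.4.9 (p. 425).**  (`T̃`, `η̃` obtained from `(T, η)` by the inverse Cayley transforms w.r.t. `Δ^∨_φ ∩ Δ(ᴸB⁰, ᴸT⁰)`; «`η̃`
induces an isomorphism `ℰ(T̃)^∨ ⥲ S_φ̃ ∩ ᴸT⁰∕Z(ᴸM̃⁰)^W`».)  «`η̃` induces a surjective homomorphism `ℰ(T̃)^∨ → 𝕊_{φ}`» (binder: the induced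
map). [cite: Shelstad1982, Prop. 5.4.9 (p. 425)] -/
def Shelstad1982_5_4_9_etaTildeOnto {SS ETt : Type u} [Group SS] [CommGroup ETt] (e : (ETt →* ℂˣ) →* SS) : Prop :=
  Function.Surjective e

/-- **PROPOSITION 5.4.11 (p. 425).**  «`η` induces an exact sequence `1 → ℰ(T)^∨ → 𝕊_{φ} → R_φ → 1`» (from (5.3.12) and Lemma 5.4.1),
for the induced maps `i`, `j` (binders). [cite: Shelstad1982, Prop. 5.4.11 (p. 425)] -/
def Shelstad1982_5_4_11_exact {SS RR ET : Type u} [Group SS] [Group RR] [CommGroup ET]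
    (i : (ET →* ℂˣ) →* SS) (j : SS →* RR) : Prop :=
  Function.Injective i ∧ Function.Surjective j ∧ j.ker = i.range

/-- **PROPOSITION 5.4.12 + COROLLARY 5.4.13 (p. 425).**  «`η̃` induces a surjective homomorphism `ℰ(T̃)^∨ → R_φ`. The kernel of this
homomorphism is the annihilator of `⟨Δ^∨_φ⟩` in `ℰ(T̃)^∨`» (`⟨Δ^∨_φ⟩` ⊂ `ℰ(T̃)` the submodule generated by the cosets of the coroots in
`Δ^∨_φ`, a binder); COR 5.4.13: «The dual of the homomorphism `ℰ(T̃)^∨ → R_φ` embeds `R_φ^∨` in `ℰ(T̃)`» (its image, `⟨Δ^∨_φ⟩`, «is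
identified with `Ω(M̃, T̃) ∩ Ω(Δ^∨_φ)∕Ω(Δ^∨_φ)`» under Tate–Nakayama — recorded, not typed). [cite: Shelstad1982, Prop. 5.4.12, Cor. 5.4.13 (p. 425)] -/
def Shelstad1982_5_4_12_etaTildeOntoR {RR ETt : Type u} [Group RR] [CommGroup ETt] (r : (ETt →* ℂˣ) →* RR)
    (spanDelta : Subgroup ETt) : Prop :=
  Function.Surjective r ∧ ∀ θ : ETt →* ℂˣ, θ ∈ r.ker ↔ ∀ a ∈ spanDelta, θ a = 1

/-- **PROPOSITION 5.4.24 (p. 428).**  (General `φ`, `ᴸM̄ ≠ ᴸG` allowed; `𝔰(x)` the representative attached to `x`, `𝔰(x)^g` its transport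
to `M̂ = M_{T̂}`, `T̂ = g T̄ g⁻¹`; `𝔰^M̂_H` of (3.4).)  «There exist `𝔰_H` among the fixed representatives for `𝔖(ᴸG)` and Cartan subgroup
`T̂ = g T̄ g⁻¹`, `g ∈ G`, together with a p.d. `η̂` of `𝐓̂`, such that (i) `σ_H` satisfies (3.4.1) relative to `(T̂, η̂)`, and (ii) `𝔰(x̄)^g` is
equivalent to `𝔰^M̂_H` relative to `M̂`.»  Typed over explicit binders for the finite stock of fixed representatives, the real group `G`,
and the two printed conditions as predicates of `(𝔰_H, g, η̂)`. [cite: Shelstad1982, Prop. 5.4.24 (p. 428)] -/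
def Shelstad1982_5_4_24_adaptedData {G Reps PD : Type u} [Group G] (fixedReps : Set Reps)
    (cond_i cond_ii : Reps → G → PD → Prop) : Prop :=
  ∃ sH ∈ fixedReps, ∃ (g : G) (η : PD), cond_i sH g η ∧ cond_ii sH g η

end SGroupDatum

/-! ## §5.3 — the root-space statements: the dictionary `RootSpaceDatum` -/

/-- **The root-space data of §5.3 (pp. 418–421)** (data only), for `φ = φ(μ, λ)` factoring through `ᴸM`, `μ` `Δ(ᴸM⁰, ᴸT⁰)`-regular.  `Lg` =
`ᴸ𝔤`.  Fields: `Root` = `Δ(ᴸ𝔤, ᴸ𝔱)` (coroots `α^∨`); `X α` = the root vector `X_{α^∨}`; `neg` = `α^∨ ↦ −α^∨`; `sigmaR` = `φ(1 × σ)` on roots,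
`sigmaL` = `φ(1 × σ)` on `ᴸ𝔤`; `pairMu α` = `⟨μ, α^∨⟩`; `frakXrel α β` = «`β^∨ ∈ 𝔛_{α^∨}` = {`β^∨` : `β^∨|ᴸ𝔱_φ = c α^∨|ᴸ𝔱_φ`, some `c > 0`}»
(p. 419); `frak_s` = `𝔰 = 𝔰_φ` (Lie `S_φ`) and `Ltphi` = `ᴸ𝔱_φ = {X ∈ ᴸ𝔱 : φ(1 × σ)X = X}` as subspaces of `ᴸ𝔤` (p. 418); `IsRootS α` = «`α^∨|ᴸ𝔱_φ`
is a root of `(𝔰_φ, ᴸ𝔱_φ)`»; `Qzero α` = «`Qα^∨ = 0`», `Q = [R_φ]⁻¹ Σ_{r ∈ R_φ} r` (p. 420); `DeltaPhi` = «`Δ^∨_φ = {α^∨ : ⟨μ, α^∨⟩ = 0, Qα^∨ =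
0}`» kept as a field and tied to `pairMu`, `Qzero` by `Shelstad1982_5_3_13_DeltaPhi`; `IsSum α β γ` = «`α^∨ = β^∨ + γ^∨`»; `plancherelZero
α` = «`μ_{α|𝔞} = 0`», `indivisible α` = «`α|𝔞` is indivisible» (p. 421); `rhoPair α` = `⟨2λ + ρ_α, α^∨⟩ ∈ ℤ` (p. 421).
[cite: Shelstad1982, §5.3 pp. 418–421] -/
structure RootSpaceDatum (Lg : Type u) [AddCommGroup Lg] [Module ℂ Lg] where
  /-- `Δ(ᴸ𝔤, ᴸ𝔱)`. -/
  Root : Type u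
  /-- `X_{α^∨}` (p. 419). -/
  X : Root → Lg
  /-- `−α^∨`. -/
  neg : Root → Root
  /-- `φ(1 × σ)` on roots (p. 419). -/
  sigmaR : Root → Root
  /-- `φ(1 × σ)` on `ᴸ𝔤` (p. 419). -/
  sigmaL : Lg →ₗ[ℂ] Lg
  /-- `⟨μ, α^∨⟩` (p. 419). -/
  pairMu : Root → ℂ
  /-- `β^∨ ∈ 𝔛_{α^∨}` (p. 419). -/
  frakXrel : Root → Root → Prop
  /-- `𝔰 = 𝔰_φ` (p. 418). -/
  frak_s : Submodule ℂ Lg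
  /-- `ᴸ𝔱_φ` (p. 418). -/
  Ltphi : Submodule ℂ Lg
  /-- «`α^∨|ᴸ𝔱_φ` is a root of `(𝔰_φ, ᴸ𝔱_φ)`». -/
  IsRootS : Root → Prop
  /-- «`Qα^∨ = 0`» (p. 420). -/
  Qzero : Root → Prop
  /-- `Δ^∨_φ` (p. 420). -/
  DeltaPhi : Set Root
  /-- «`α^∨ = β^∨ + γ^∨`». -/
  IsSum : Root → Root → Root → Prop
  /-- «`μ_{α|𝔞} = 0`» (p. 421). -/
  plancherelZero : Root → Prop
  /-- «`α|𝔞` is indivisible» (p. 421). -/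
  indivisible : Root → Prop
  /-- `⟨2λ + ρ_α, α^∨⟩` (p. 421). -/
  rhoPair : Root → ℤ

namespace RootSpaceDatum

variable {Lg : Type u} [AddCommGroup Lg] [Module ℂ Lg] (R : RootSpaceDatum Lg)

/-- **`𝔰_{α^∨} = 𝔰 ∩ Σ_{β^∨ ∈ 𝔛_{α^∨}} ℂ X_{β^∨}`** (p. 419). [cite: Shelstad1982, §5.3 p. 419] -/
def frakS (α : R.Root) : Submodule ℂ Lg :=
  R.frak_s ⊓ Submodule.span ℂ (R.X '' {β | R.frakXrel α β})

/-- **PROPOSITION 5.3.2 (p. 418)** «`ᴸ𝔱_φ` is a Cartan subalgebra of `𝔰_φ`» and **COROLLARY 5.3.10 (p. 420)** «The non-zero spaces among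
the `𝔰_{α^∨}`'s are precisely the root spaces for `(𝔰_φ, ᴸ𝔱_φ)`», typed together as the root-space decomposition they assert: `ᴸ𝔱_φ ≤ 𝔰`,
and `𝔰` is the sup of `ᴸ𝔱_φ` and the non-zero `𝔰_{α^∨}`, these being exactly the `𝔰_{α^∨}` with `α^∨|ᴸ𝔱_φ` a root (the bracket structure of
«Cartan subalgebra», [7, Lemma 3.2], is not modelled on the bare module `ᴸ𝔤`). [cite: Shelstad1982, Prop. 5.3.2 (p. 418); Cor. 5.3.10 (p. 420)] -/
def Shelstad1982_5_3_2_cartanSubalgebra : Prop :=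
  R.Ltphi ≤ R.frak_s ∧ (R.frak_s = R.Ltphi ⊔ ⨆ α : R.Root, R.frakS α) ∧
    ∀ α : R.Root, (R.frakS α ≠ ⊥ ↔ R.IsRootS α)

/-- **PROPOSITION 5.3.3 (p. 419).**  «`Ω_φ(ᴸG⁰, ᴸT⁰) = A_{S_φ}(𝔰_φ, ᴸ𝔱_φ)`», `A_{S_φ}(𝔰_φ, ᴸ𝔱_φ)` = «the group of automorphisms of `𝔰_φ` which
preserve `ᴸ𝔱_φ` and are of the form `Ad s`, `s ∈ S_φ`, modulo `Ad(ᴸT⁰ ∩ S_φ)`» (p. 418) — proof: «if `s ∈ S_φ` fixes `ᴸ𝔱_φ` then `s ∈ ᴸT⁰`».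
Typed on an `SGroupDatum` `D` and `Ad : LG → (Lg →ₗ Lg)` (binder) as the printed key fact + the surjectivity it yields: a `s ∈ S_φ` with
`Ad s` fixing `ᴸ𝔱_φ` pointwise lies in `ᴸT⁰`; and every `s ∈ S_φ` with `Ad s` preserving `ᴸ𝔱_φ` acts on `𝔰_φ` as `Ad s′ ∘ Ad t` for some
`s′ ∈ S_φ ∩ N(ᴸT⁰)` (a realized Weyl element) and `t ∈ ᴸT⁰ ∩ S_φ` («modulo `Ad(ᴸT⁰ ∩ S_φ)`»). [cite: Shelstad1982, Prop. 5.3.3 (p. 419)] -/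
def Shelstad1982_5_3_3_realizedEqAut {LG Lt : Type u} [Group LG] [AddCommGroup Lt] [Module ℂ Lt]
    (D : SGroupDatum LG Lt) (Ad : LG → Lg →ₗ[ℂ] Lg) : Prop :=
  (∀ s ∈ D.Sphi, (∀ X ∈ R.Ltphi, Ad s X = X) → s ∈ D.LT0) ∧
    ∀ s ∈ D.Sphi, (∀ X ∈ R.Ltphi, Ad s X ∈ R.Ltphi) →
      ∃ s' ∈ D.Sphi ⊓ D.normLT0, ∃ t ∈ D.LT0 ⊓ D.Sphi, ∀ X ∈ R.frak_s, Ad s X = Ad s' (Ad t X)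

/-- **PROPOSITION 5.3.4 (p. 419), displays (5.3.5)–(5.3.9).**  «Suppose that `φ(1 × σ)α^∨ = α^∨`. Then `𝔰_{α^∨} =` (5.3.5) `ℂX_{α^∨}` if
`φ(1 × σ)X_{α^∨} = X_{α^∨}`, `⟨μ, α^∨⟩ = 0`; (5.3.6) `ℂ(X_{β^∨} + φ(1 × σ)X_{β^∨})` if `α^∨ = β^∨ + φ(1 × σ)β^∨`, where `⟨μ, β^∨⟩ = 0`; (5.3.7) `0`
otherwise. In case of (5.3.5) and (5.3.7), `⟨μ, γ^∨⟩ ≠ 0` for all `γ^∨ ∈ 𝔛_{α^∨}` distinct from `α^∨`; in case of (5.3.6),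
`φ(1 × σ)X_{α^∨} = −X_{α^∨}`, `β^∨` is uniquely determined and `⟨μ, γ^∨⟩ ≠ 0` for all `γ^∨ ∈ 𝔛_{α^∨}` distinct from `α^∨, β^∨, φ(1 × σ)β^∨`.
Suppose that `φ(1 × σ)β^∨ ≠ β^∨` for all `β^∨ ∈ 𝔛_{α^∨}`. Then there exists at most one root `β^∨ ∈ 𝔛_{α^∨}` such that `⟨μ, β^∨⟩ = 0`, and
`𝔰_{α^∨} =` (5.3.8) `ℂ(X_{β^∨} + φ(1 × σ)X_{β^∨})` if `β^∨ ∈ 𝔛_{α^∨}` and `⟨μ, β^∨⟩ = 0`; (5.3.9) `0` if `⟨μ, β^∨⟩ ≠ 0`, `β^∨ ∈ 𝔛_{α^∨}`.»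
[cite: Shelstad1982, Prop. 5.3.4 (5.3.5)–(5.3.9) (p. 419)] -/
def Shelstad1982_5_3_4_rootSpaces : Prop :=
  (∀ α : R.Root, R.sigmaR α = α →
    -- (5.3.5)
    ((R.sigmaL (R.X α) = R.X α ∧ R.pairMu α = 0 →
        R.frakS α = Submodule.span ℂ {R.X α} ∧ ∀ γ, R.frakXrel α γ → γ ≠ α → R.pairMu γ ≠ 0) ∧
    -- (5.3.6)
      (∀ β, R.IsSum α β (R.sigmaR β) → R.pairMu β = 0 →
        R.frakS α = Submodule.span ℂ {R.X β + R.sigmaL (R.X β)} ∧ R.sigmaL (R.X α) = -R.X α ∧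
          (∀ β', R.IsSum α β' (R.sigmaR β') → R.pairMu β' = 0 → β' = β) ∧
            ∀ γ, R.frakXrel α γ → γ ≠ α → γ ≠ β → γ ≠ R.sigmaR β → R.pairMu γ ≠ 0) ∧
    -- (5.3.7)
      (¬ (R.sigmaL (R.X α) = R.X α ∧ R.pairMu α = 0) → (∀ β, ¬ (R.IsSum α β (R.sigmaR β) ∧ R.pairMu β = 0)) →
        R.frakS α = ⊥ ∧ ∀ γ, R.frakXrel α γ → γ ≠ α → R.pairMu γ ≠ 0))) ∧
  -- (5.3.8), (5.3.9)
  ∀ α : R.Root, (∀ β, R.frakXrel α β → R.sigmaR β ≠ β) →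
    (∀ β β', R.frakXrel α β → R.frakXrel α β' → R.pairMu β = 0 → R.pairMu β' = 0 → β = β') ∧
      (∀ β, R.frakXrel α β → R.pairMu β = 0 → R.frakS α = Submodule.span ℂ {R.X β + R.sigmaL (R.X β)}) ∧
        ((∀ β, R.frakXrel α β → R.pairMu β ≠ 0) → R.frakS α = ⊥)

/-- **(5.3.11) (p. 420)**: «`A_{S_φ}(𝔰_φ, ᴸ𝔱_φ) = R_φ Ω(𝔰_φ, ᴸ𝔱_φ)`, where `R_φ = A_{S_φ}(𝔰_φ, 𝔰_φ⁺, ᴸ𝔱_φ)`, the group of elements … preserving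
`𝔰_φ⁺`» (the Borel subalgebra determined by `Δ(ᴸB⁰, ᴸT⁰)`): every element of the group `A = A_{S_φ}(𝔰_φ, ᴸ𝔱_φ)` is a product `r·w`,
`r ∈ R_φ`, `w ∈ Ω(𝔰_φ, ᴸ𝔱_φ)` (binders: the group `A`, its subgroups `R_φ`, `Ω`; print's further structure — `Ω` normal, `R_φ ∩ Ω = 1`, so
`A∕Ω ≅ R_φ` as used in (5.3.12) — is not asserted here). [cite: Shelstad1982, §5.3 (5.3.11) (p. 420)] -/
def Shelstad1982_5_3_11_semidirect {A : Type u} [Group A] (Rphi Ω : Subgroup A) : Prop :=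
  ∀ a : A, ∃ r ∈ Rphi, ∃ w ∈ Ω, a = r * w

/-- **LEMMA 5.3.13 (p. 420).**  «Let `Δ^∨_φ = {α^∨ ∈ Δ(ᴸ𝔤, ᴸ𝔱) : ⟨μ, α^∨⟩ = 0, Qα^∨ = 0}`. Then (i) if `α^∨ ∈ Δ^∨_φ` then `φ(1 × σ)α^∨ = α^∨` and
`φ(1 × σ)X_{α^∨} = −X_{α^∨}`, (ii) `Δ^∨_φ` is of type `A₁ × A₁ × … × A₁`, (iii) `R_φ` is contained in `Ω(Δ^∨_φ)`, the Weyl group generated by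
`Δ^∨_φ`, and (iv) each `α^∨ ∈ Δ^∨_φ` appears in the expression of some `r ∈ R_φ` as a product of distinct reflections in `Ω(Δ^∨_φ)`.»  (ii) is
typed as «strongly orthogonal: no `α^∨ ± β^∨` is a root for distinct `α^∨, β^∨ ∈ Δ^∨_φ`» (print's proof: «`α^∨ + β^∨` is not a root»); (iii),
(iv) on a Weyl-group binder `Ω` with the reflections `refl α` and `R_φ ≤ Ω`. [cite: Shelstad1982, Lemma 5.3.13 (p. 420)] -/
def Shelstad1982_5_3_13_DeltaPhi {Ω : Type u} [Group Ω] (refl : R.Root → Ω) (Rphi : Subgroup Ω) : Prop :=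
  R.DeltaPhi = {α | R.pairMu α = 0 ∧ R.Qzero α} ∧
    (∀ α ∈ R.DeltaPhi, R.sigmaR α = α ∧ R.sigmaL (R.X α) = -R.X α) ∧
      (∀ α ∈ R.DeltaPhi, ∀ β ∈ R.DeltaPhi, α ≠ β → ∀ γ : R.Root, ¬ R.IsSum γ α β ∧ ¬ R.IsSum γ α (R.neg β)) ∧
        Rphi ≤ Subgroup.closure (refl '' R.DeltaPhi) ∧
          ∀ α ∈ R.DeltaPhi, ∃ r ∈ Rphi, ∃ l : List R.Root,
            l.Nodup ∧ α ∈ l ∧ (∀ β ∈ l, β ∈ R.DeltaPhi) ∧ (l.map refl).prod = r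

/-- **LEMMA 5.3.15 (p. 421).**  (`𝔞` the split part of `𝔱`; `μ_α̃` the Plancherel factor attached to the root `α̃` of `(𝔤, 𝔞)` and any
representation in `Π^M_φ`.)  «`α^∨|ᴸ𝔱_φ` is a root of `(𝔰_φ, ᴸ𝔱_φ)` if and only if `μ_{α|𝔞} = 0` and `α|𝔞` is indivisible.»
[cite: Shelstad1982, Lemma 5.3.15 (p. 421)] -/
def Shelstad1982_5_3_15_rootIffPlancherel : Prop :=
  ∀ α : R.Root, R.IsRootS α ↔ R.plancherelZero α ∧ R.indivisible α

/-- **(5.3.16)–(5.3.18) (pp. 421–422).**  For `φ(1 × σ)α^∨ = α^∨` (with `ρ_α` = one-half the sum of the roots `β` with `β^∨ ∈ 𝔛_{α^∨}`):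
«(5.3.16) `φ(1 × σ)X_{α^∨} = −(−1)^{⟨2λ + ρ_α, α^∨⟩} X_{α^∨}`» ([1]), and «`α^∨ ∈ Δ(𝔰_φ, ᴸ𝔱_φ)` if and only if either (5.3.17)
`(−1)^{⟨2λ+ρ_α,α^∨⟩} = −1` and `⟨μ, α^∨⟩ = 0`, or (5.3.18) `(−1)^{⟨2λ+ρ_α,α^∨⟩} = 1`, `⟨μ, α^∨⟩ = 0` and `⟨μ, β^∨⟩ = 0` for some `β^∨ ∈ 𝔛_{α^∨}` different
from `α^∨`. Moreover, if `(−1)^{⟨2λ+ρ_α,α^∨⟩} = −1` and `⟨μ, α^∨⟩ ≠ 0` then `⟨μ, β^∨⟩ ≠ 0` for all `β^∨ ∈ 𝔛_{α^∨}`.»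
[cite: Shelstad1982, §5.3 (5.3.16)–(5.3.18) (pp. 421–422)] -/
def Shelstad1982_5_3_16_sigmaOnRootVector : Prop :=
  ∀ α : R.Root, R.sigmaR α = α →
    R.sigmaL (R.X α) = -((-1 : ℂ) ^ R.rhoPair α) • R.X α ∧
      (R.IsRootS α ↔
        ((-1 : ℤ) ^ (R.rhoPair α).natAbs = -1 ∧ R.pairMu α = 0) ∨
          ((-1 : ℤ) ^ (R.rhoPair α).natAbs = 1 ∧ R.pairMu α = 0 ∧ ∃ β, R.frakXrel α β ∧ β ≠ α ∧ R.pairMu β = 0)) ∧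
      ((-1 : ℤ) ^ (R.rhoPair α).natAbs = -1 → R.pairMu α ≠ 0 → ∀ β, R.frakXrel α β → R.pairMu β ≠ 0)

/-- **PROPOSITION 5.4.2 (p. 423)** (general tempered `φ`; `ᴸM̃⁰ ⊇ ᴸT⁰` the subgroup with root system `{α^∨ : φ(1 × σ)α^∨ = −𝛚α^∨}`,
`𝛚 = ∏ ω_{α^∨}` over positive `α^∨ ∈ Δ^∨_φ`; its roots = the binder `rootsMtilde`): «(i) `Δ(ᴸM̃⁰, ᴸT⁰)` contains `Δ^∨_φ`. (ii) If
`α^∨ ∈ Δ(ᴸM̃⁰, ᴸT⁰)` and `⟨μ, α^∨⟩ = 0` then `α^∨ ∈ Δ^∨_φ`.» [cite: Shelstad1982, Prop. 5.4.2 (p. 423)] -/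
def Shelstad1982_5_4_2_DeltaPhiInLeviTilde (rootsMtilde : Set R.Root) : Prop :=
  R.DeltaPhi ⊆ rootsMtilde ∧ ∀ α ∈ rootsMtilde, R.pairMu α = 0 → α ∈ R.DeltaPhi

/-- **PROPOSITION 5.4.3 (p. 423).**  «`φ̃ = ad s ∘ φ` has the following properties: (i) `φ̃(W) ⊂ ᴸM̃`, (ii) `φ̃(ℂ^×) ⊂ ᴸT⁰ × ℂ^×` and `φ̃(1 × σ)`
normalizes `ᴸT⁰`, acting as `−1` on the roots of `(ᴸM̃⁰, ᴸT⁰)`, and (iii) if `φ̃ = φ(μ̃, λ̃)` relative to `M̃` then `μ̃ = μ` and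
`λ̃ ≡ λ mod {X_*(ᴸT⁰)} + {v − φ̃(1 × σ)v : v ∈ X_*(ᴸT⁰) ⊗ ℂ}`.»  Typed on an `SGroupDatum` `D` (for `μ, λ`, the lattice) with binders: the
images `imW ⊆ LG` of `φ̃(W)` (projected to `ᴸG⁰`-cosets' first components) and `imC` of `φ̃(ℂ^×)`, the subgroup `LMt` (`ᴸM̃⁰`), `sigmaTt`
(`φ̃(1 × σ)` on `LG` and on roots∕`ᴸ𝔱`), `muT, lamT`. [cite: Shelstad1982, Prop. 5.4.3 (p. 423)] -/
def Shelstad1982_5_4_3_phiTilde {LG Lt : Type u} [Group LG] [AddCommGroup Lt] [Module ℂ Lt] (D : SGroupDatum LG Lt)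
    (imW imC : Set LG) (LMt : Subgroup LG) (rootsMtilde : Set R.Root) (sigmaTt : LG → LG) (sigmaRt : R.Root → R.Root)
    (sigmaLtt : Lt →ₗ[ℂ] Lt) (muT lamT : Lt) : Prop :=
  imW ⊆ LMt ∧ imC ⊆ D.LT0 ∧ (∀ t ∈ D.LT0, sigmaTt t ∈ D.LT0) ∧ (∀ α ∈ rootsMtilde, sigmaRt α = R.neg α) ∧
    muT = D.mu ∧ ∃ v ∈ D.latt, ∃ w : Lt, lamT - D.lam = v + (w - sigmaLtt w)

end RootSpaceDatum

/-! ## §5.2 ∕ §5.4 — packets, the pairing and the character identities: the dictionary `PacketPairing` -/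

/-- **The packet-side data of §5.2∕§5.4 for one class `{φ} ∈ Φ₀(G)`** over block A's `LiftingSetting L` and the finite group `𝕊_φ` (data
only).  Fields: `phi` = `{φ}`; `pair 𝔵 π` = «`⟨𝔵, π⟩`», the pairing `𝕊_{φ} × Π_{φ} → {±1}` (p. 416 «`⟨𝔵, π(ω, Ψ)⟩ = κ^{g⁻¹}(ω)`»; p. 427 «`⟨𝔵, π⟩ =
x(ω̄_σ)`»; LEMMA 5.4.20), values in `ℤˣ = {±1}`, used for `π ∈ Π_φ`; `phiH 𝔵` = the class `{φ′}` for `H` attached to `𝔵` («to each `𝔵 ∈ 𝕊_{φ}`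
we have attached `𝔰(𝔵)` equivalent to some `𝔰_H` … and a parameter `{φ′}` for `H` which lifts to `{φ}` (or more precisely, a family
`{φ′_τ}` …)», p. 416; one member chosen); `hatScalar 𝔵` = the scalar `ε(T, η) det g κ(g⁻¹)` of §5.2 (p. 416), resp. `ε(Ψ̄)ε(T̄, η̄) det g κ̄(g⁻¹)`
(COR 5.4.23, p. 428), resp. `c = ±1` times it in the general case (5.4.25) (p. 429); `chiHat 𝔵` = «`χ̂_{({φ},𝔵)}(f) = ε(T,η) det g κ(g⁻¹)
χ_{φ′}(f_H)`» (p. 416; p. 428) as a distribution on `G`; `asChar 𝔵`, `omegaSigma π` = «regard `𝔵` as a character on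
`X_*(T_sc)∕X_*(T_sc) ∩ {v^∨ − σ̄v^∨}`», «`ω̃_σ` the element of this quotient determined by `ω` and `η`» for `π = π(ω, Ψ)` (p. 417; p. 427
`ω̄_σ`) on an abstract carrier `TN`. [cite: Shelstad1982, §5.2 pp. 416–417; §5.4 pp. 427–429] -/
structure PacketPairing {G H : Type u} [Group G] [Group H] (L : LiftingSetting G H) (SS : Type u) [Group SS] where
  /-- `{φ} ∈ Φ₀(G)`. -/
  phi : L.SG.Param
  /-- `⟨𝔵, π⟩ ∈ {±1}` (pp. 416, 427). -/
  pair : SS → L.Rep → ℤˣ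
  /-- `{φ′}` attached to `𝔵` (p. 416; p. 428). -/
  phiH : SS → L.SH.Param
  /-- `ε(T,η) det g κ(g⁻¹)` ∕ `ε(Ψ̄)ε(T̄,η̄) det g κ̄(g⁻¹)` ∕ `c·(…)` (pp. 416, 428, 429). -/
  hatScalar : SS → ℂ
  /-- `χ̂_{({φ},𝔵)}` (pp. 416–417, 428). -/
  chiHat : SS → Module.Dual ℂ L.SG.schwartz
  /-- The Tate–Nakayama quotient `X_*(T_sc)∕X_*(T_sc) ∩ {v^∨ − σ̄v^∨}` (p. 417; p. 427). -/
  TN : Type u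
  /-- `𝔵` as a character on `TN` (p. 417; p. 427 `x`). -/
  asChar : SS → TN → ℤˣ
  /-- `ω̃_σ` ∕ `ω̄_σ` for `π = π(ω, Ψ)` ∕ `π(ω̄)` (pp. 417, 427). -/
  omegaSigma : L.Rep → TN

namespace PacketPairing

variable {G H : Type u} [Group G] [Group H] {L : LiftingSetting G H} {SS : Type u} [Group SS] (P : PacketPairing L SS)

/-- `⟨𝔵, π⟩` as a complex number (`±1`). [cite: Shelstad1982, §5.2 p. 417] -/
def pairC (x : SS) (π : L.Rep) : ℂ :=
  ((P.pair x π : ℤ) : ℂ)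

/-- **A GHOST** (p. 417: «`Π̄_φ` … in 1–1 correspondence with `𝕊_φ^∨`. If `π̄ ∈ Π̄_φ − Π_φ`, let `𝔵 ↦ ⟨𝔵, π̄⟩` denote the character on `𝕊_φ`
corresponding to `π̄` and define the character `χ_π̄` of `π̄` to be the zero distribution on `G`. We will call `π̄` a *ghost*»; p. 427
likewise): a `{±1}`-valued character `θ` of `𝕊_φ` that is not `⟨·, π⟩` for any `π ∈ Π_φ`. [cite: Shelstad1982, §5.2 p. 417; §5.4 p. 427] -/
def IsGhostCharacter (θ : SS →* ℤˣ) : Prop :=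
  ∀ π ∈ L.packet P.phi, ∃ x : SS, θ x ≠ P.pair x π

/-- **p. 416 (discrete case) ∕ LEMMA 5.4.22 (p. 428): `ε(π)` through the pairing.**  «`ε(π(ω, Ψ)) = ε(T, η) det g κ(g⁻¹) κ^{g⁻¹}(ω)`,
`ω ∈ Ω(𝐆, 𝐓)`» and «`⟨𝔵, π(ω, Ψ)⟩ = κ^{g⁻¹}(ω)`» (p. 416); LEMMA 5.4.22: «`ε(π(ω̄)) = ε(Ψ̄) ε(T̄, η̄) det g κ̄(g⁻¹) ⟨𝔵, π(ω)⟩`» — i.e.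
`ε(π) = hatScalar(𝔵) · ⟨𝔵, π⟩` on `Π_φ`, `ε` being block A's signs for the lift of `χ_{φ′}`, `φ′ = φ′(𝔵)`.
[cite: Shelstad1982, §5.2 p. 416; Lemma 5.4.22 (p. 428)] -/
def Shelstad1982_5_2_epsViaPairing : Prop :=
  ∀ (x : SS), ∀ π ∈ L.packet P.phi, L.eps (P.phiH x) π = P.hatScalar x * P.pairC x π

/-- **`χ̂` through the lift (p. 416; COR 5.4.23 p. 428; p. 429).**  «`χ̂_{{φ′}}(f_H) = ε(T, η) det g κ(g⁻¹) χ_{{φ′}}(f_H)`» ∕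
«`χ̂_{({φ},𝔵)}(f) = ε(Ψ̄)ε(T̄,η̄) det g κ̄(g⁻¹) χ_{{φ′}}(f_H)`» ∕ «`χ̂_{({φ},𝔵)}(f) = c χ^H_{φ̂′}(f_H)`»: with `χ_{φ′}(f_H) = (Lift χ_{φ′})(f)` (block A's
`IsLift`), `χ̂_{({φ},𝔵)} = hatScalar(𝔵) · Lift χ_{φ′(𝔵)}`. [cite: Shelstad1982, §5.2 p. 416; Cor. 5.4.23 (p. 428); §5.4 p. 429] -/
def Shelstad1982_5_2_chiHatViaLift : Prop :=
  ∀ (x : SS) (Θ : Module.Dual ℂ L.SG.schwartz), L.IsLift (L.SH.chi (P.phiH x)) Θ → P.chiHat x = P.hatScalar x • Θ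

/-- **PROPOSITION 5.2.4 (p. 417)** «`⟨𝔵, π(ω, Ψ)⟩ = 𝔵(ω̃_σ)`. The proof is immediate» ∕ p. 427 «we set `⟨𝔵, π⟩ = x(ω̄_σ)`».
[cite: Shelstad1982, Prop. 5.2.4 (p. 417); §5.4 p. 427] -/
def Shelstad1982_5_2_4_pairingViaTateNakayama : Prop :=
  ∀ (x : SS), ∀ π ∈ L.packet P.phi, P.pair x π = P.asChar x (P.omegaSigma π)

/-- **COROLLARY 5.2.5 (p. 417) ∕ LEMMAS 5.4.19, 5.4.20, COROLLARY 5.4.23 (pp. 427–428) — independence of the choices.**  «(i) `⟨𝔵, π⟩` is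
independent of the choice for `𝔰_H = (s_H, ᴸH)`, `ξ : ᴸH ↪ ᴸG` and the family `{Δ_(T,η)}`. (ii) `χ̂_{{φ′}}(f_H)` depends only on `{φ}`, `𝔵` and
`f`»; L5.4.19 «`x(ω̄_σ)` is independent of the choice for `x`»; L5.4.20 «`⟨ , ⟩ : 𝕊_{φ} × Π_{φ} → {±1}` depends only on `{φ}` and the data
of (1.3) and (5.4.18)»; C5.4.23 «… depends only on `{φ}`, `𝔵` and `f`».  Typed: for any family of choice-indexed pairings∕hats
computed as in print (binder `Choice`, `pairOf`, `hatOf`), all members agree with each other. [cite: Shelstad1982, Cor. 5.2.5 (p. 417); Lemmas 5.4.19–5.4.20 (p. 427); Cor. 5.4.23 (p. 428)] -/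
def Shelstad1982_5_2_5_independence {Choice : Type u} (pairOf : Choice → SS → L.Rep → ℤˣ)
    (hatOf : Choice → SS → Module.Dual ℂ L.SG.schwartz) : Prop :=
  ∀ c₁ c₂ : Choice, (∀ x, ∀ π ∈ L.packet P.phi, pairOf c₁ x π = pairOf c₂ x π) ∧ ∀ x, hatOf c₁ x = hatOf c₂ x

/-- **LEMMA 5.2.6 (i) (p. 417) = LEMMA 5.4.21 (i) (p. 427).**  «`⟨𝔵𝔶, π⟩ = ⟨𝔵, π⟩⟨𝔶, π⟩` for `𝔵, 𝔶 ∈ 𝕊_{φ}`, `π ∈ Π_{φ}`.»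
[cite: Shelstad1982, Lemma 5.2.6 (i) (p. 417); Lemma 5.4.21 (i) (p. 427)] -/
def Shelstad1982_5_2_6_i_multiplicative : Prop :=
  ∀ (x y : SS), ∀ π ∈ L.packet P.phi, P.pair (x * y) π = P.pair x π * P.pair y π

/-- **LEMMA 5.2.6 (ii) (p. 417) = LEMMA 5.4.21 (ii) (p. 427).**  «`⟨𝔵, π⟩ = ⟨𝔵, π′⟩` for all `𝔵 ∈ 𝕊_{φ}` if and only if `π = π′`» (`π, π′ ∈ Π_φ`).
[cite: Shelstad1982, Lemma 5.2.6 (ii) (p. 417); Lemma 5.4.21 (ii) (p. 427)] -/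
def Shelstad1982_5_2_6_ii_separates : Prop :=
  ∀ π ∈ L.packet P.phi, ∀ π' ∈ L.packet P.phi, (∀ x : SS, P.pair x π = P.pair x π') ↔ π = π'

/-- **«We have identified `Π_φ` as a subset of `𝕊_φ^∨`, the dual of `𝕊_φ`. This subset may be proper»** (p. 417; p. 427 «Again this subset
may be proper, and so we adjoin some "ghost" representations with zero character and form `Π̄_φ` in full duality with `𝕊_φ^∨`»): every
`π ∈ Π_φ` gives the character `⟨·, π⟩ : 𝕊_φ → {±1}` (a homomorphism), distinct `π` give distinct characters — the content of LEMMA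
5.2.6; `Π̄_φ ≅ 𝕊_φ^∨` is then `Π_φ ⊔ {ghost characters}` (`IsGhostCharacter`). [cite: Shelstad1982, §5.2 p. 417; §5.4 p. 427] -/
def Shelstad1982_5_2_packetInDual : Prop :=
  ∃ ι : ↥(L.packet P.phi) → (SS →* ℤˣ), Function.Injective ι ∧ ∀ (π : ↥(L.packet P.phi)) (x : SS), ι π x = P.pair x π

/-- **(5.2.3) + THEOREM 5.2.7 (p. 417) = (5.4.25) + THEOREM 5.4.26 (p. 429).**  «Our identity then becomes (5.2.3)
`Σ_{π ∈ Π_{φ}} ⟨𝔵, π⟩ χ_π(f) = χ̂_{{φ′}}(f_H)`» and, with the ghosts adjoined («The identity (5.2.3) is then replaced by:»), THEOREM 5.2.7 ∕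
5.4.26 «`Σ_{π ∈ Π̄_φ} ⟨𝔵, π⟩ χ_π(f) = χ̂_{(φ,𝔵)}(f)`, `𝔵 ∈ 𝕊_φ`, `f ∈ 𝒞(G)`» — ghosts have `χ_π̄ = 0`, so both are the sum over `Π_φ`; one
declaration for the three printed forms. [cite: Shelstad1982, (5.2.3), Thm. 5.2.7 (p. 417); (5.4.25), Thm. 5.4.26 (p. 429)] -/
def Shelstad1982_5_4_26_endoscopicCharacterIdentity : Prop :=
  ∀ (x : SS) (f : L.SG.schwartz), ∑ π ∈ L.packet P.phi, P.pairC x π * L.charOf π f = P.chiHat x f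

/-- **THEOREM 5.2.8 (p. 417) = THEOREM 5.4.27 (p. 429).**  «`χ_π(f) = [𝕊_φ]⁻¹ Σ_{𝔵 ∈ 𝕊_φ} ⟨𝔵, π⟩ χ̂_{(φ,𝔵)}(f)`, `π ∈ Π̄_φ`, `f ∈ 𝒞(G)`» — for
`π ∈ Π_φ`; for ghosts it is COROLLARY 5.2.9∕5.4.28. [cite: Shelstad1982, Thm. 5.2.8 (p. 417); Thm. 5.4.27 (p. 429)] -/
def Shelstad1982_5_4_27_inversion [Fintype SS] : Prop :=
  ∀ π ∈ L.packet P.phi, ∀ f : L.SG.schwartz,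
    L.charOf π f = (Fintype.card SS : ℂ)⁻¹ * ∑ x : SS, P.pairC x π * P.chiHat x f

/-- **COROLLARY 5.2.9 (p. 417) = COROLLARY 5.4.28 (p. 430).**  «If `π ∈ Π̄_φ − Π_φ` then `Σ_{𝔵 ∈ 𝕊_φ} ⟨𝔵, π⟩ χ̂_{(φ,𝔵)}(f) = 0`, `f ∈ 𝒞(G)`» — for
every ghost character `θ`. [cite: Shelstad1982, Cor. 5.2.9 (p. 417); Cor. 5.4.28 (p. 430)] -/
def Shelstad1982_5_4_28_ghostVanishing [Fintype SS] : Prop :=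
  ∀ θ : SS →* ℤˣ, P.IsGhostCharacter θ →
    ∀ f : L.SG.schwartz, ∑ x : SS, ((θ x : ℤ) : ℂ) * P.chiHat x f = 0

/-- **p. 427 — packet counts.**  «Note that `[Π_φ] = [𝔇(T)][R_φ]`, where `𝔇(T) = Ω(M,T)∖Ω(𝐌,𝐓)` … and `[𝕊_φ^∨] = [ℰ(T)][R_φ]` by Lemma 5.4.11.
On the other hand, the number of ghosts in the discrete packet `Π̄^M_φ` is `[ℰ(T)] − [𝔇(T)]`. We have therefore added exactly `[R_φ]` ghosts to
`Π_φ` for each ghost in `Π̄^M_φ`» — binders for the three cardinals; `[𝕊_φ^∨] = [𝕊_φ]` (finite abelian), so the ghosts number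
`[𝕊_φ] − [Π_φ] = [R_φ]([ℰ(T)] − [𝔇(T)])`, `[𝔇(T)] ≤ [ℰ(T)]`. [cite: Shelstad1982, §5.4 p. 427] -/
def Shelstad1982_5_4_packetCount [Fintype SS] (cardD cardE cardR : ℕ) : Prop :=
  (L.packet P.phi).card = cardD * cardR ∧ Fintype.card SS = cardE * cardR ∧ cardD ≤ cardE

end PacketPairing

/-! ## «The inversion is immediate» (p. 429) — the finite Fourier inversion behind 5.2.8∕5.2.9∕5.4.27∕5.4.28, PROVED -/

section Inversion

variable {S : Type*} [Group S] [Fintype S]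

/-- A `{±1}`-valued multiplicative function on a finite group that is not identically `1` sums to `0` in `ℂ` (translate the sum by a
`y` with `ψ(y) = −1`) — private helper for the inversion below. [folklore] -/
private theorem sum_signHom_eq_zero (ψ : S → ℤˣ) (hmul : ∀ x y, ψ (x * y) = ψ x * ψ y) (hne : ∃ y, ψ y ≠ 1) :
    ∑ x : S, ((ψ x : ℤ) : ℂ) = 0 := by
  obtain ⟨y, hy⟩ := hne
  have hy' : ψ y = -1 := (Int.units_eq_one_or (ψ y)).resolve_left hy
  have key : ∑ x : S, ((ψ x : ℤ) : ℂ) = ∑ x : S, ((ψ (y * x) : ℤ) : ℂ) :=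
    (Fintype.sum_equiv (Equiv.mulLeft y) _ _ (fun x => rfl)).symm
  have key2 : ∑ x : S, ((ψ (y * x) : ℤ) : ℂ) = -∑ x : S, ((ψ x : ℤ) : ℂ) := by
    rw [← Finset.sum_neg_distrib]
    refine Finset.sum_congr rfl fun x _ => ?_
    rw [hmul, hy', Units.val_mul, Int.cast_mul]
    simp
  have h2 : (2 : ℂ) * ∑ x : S, ((ψ x : ℤ) : ℂ) = 0 := by
    rw [two_mul]
    nth_rewrite 1 [key, key2]
    ring
  simpa using h2

variable {ι : Type*}

/-- **Inversion** (the argument of p. 417: «`Σ_𝔵 Σ_π ⟨𝔵,π⟩⟨𝔵,π₀⟩χ_π(f) = Σ_𝔵 ⟨𝔵,π₀⟩χ̂_{(φ,𝔵)}(f)`. We therefore conclude: Theorem 5.2.8»).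
For a `{±1}`-pairing on a finite group `S` and a finite set `P`, multiplicative in `𝔵` and separating the points of `P`: if
`Σ_{π ∈ P} ⟨𝔵, π⟩ a_π = b_𝔵` for all `𝔵`, then `a_{π₀} = [S]⁻¹ Σ_𝔵 ⟨𝔵, π₀⟩ b_𝔵` for `π₀ ∈ P` — the printed passage from THEOREM 5.2.7 to
THEOREM 5.2.8 (p. 417) ∕ 5.4.26 to 5.4.27 («The inversion is immediate», p. 429), with the characters `χ_π(f)`, `χ̂_{(φ,𝔵)}(f)` as the
scalars `a`, `b`. [cite: Shelstad1982, §5.2 p. 417 (inversion display); Thm. 5.4.27 (p. 429)] -/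
theorem inversion_of_pairingIdentity [DecidableEq ι] (P : Finset ι) (pair : S → ι → ℤˣ)
    (hmul : ∀ x y, ∀ π ∈ P, pair (x * y) π = pair x π * pair y π)
    (hsep : ∀ π ∈ P, ∀ π' ∈ P, (∀ x, pair x π = pair x π') → π = π')
    (a : ι → ℂ) (b : S → ℂ) (h : ∀ x, ∑ π ∈ P, ((pair x π : ℤ) : ℂ) * a π = b x) :
    ∀ π₀ ∈ P, a π₀ = (Fintype.card S : ℂ)⁻¹ * ∑ x : S, ((pair x π₀ : ℤ) : ℂ) * b x := by
  intro π₀ h₀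
  have hcard : (Fintype.card S : ℂ) ≠ 0 := Nat.cast_ne_zero.mpr Fintype.card_ne_zero
  -- expand `b` and exchange the sums
  have step : ∑ x : S, ((pair x π₀ : ℤ) : ℂ) * b x =
      ∑ π ∈ P, (∑ x : S, ((pair x π₀ : ℤ) : ℂ) * ((pair x π : ℤ) : ℂ)) * a π := by
    calc ∑ x : S, ((pair x π₀ : ℤ) : ℂ) * b x
        = ∑ x : S, ∑ π ∈ P, ((pair x π₀ : ℤ) : ℂ) * ((pair x π : ℤ) : ℂ) * a π := by
          refine Finset.sum_congr rfl fun x _ => ?_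
          rw [← h x, Finset.mul_sum]
          refine Finset.sum_congr rfl fun π _ => ?_
          ring
      _ = ∑ π ∈ P, ∑ x : S, ((pair x π₀ : ℤ) : ℂ) * ((pair x π : ℤ) : ℂ) * a π := Finset.sum_comm
      _ = ∑ π ∈ P, (∑ x : S, ((pair x π₀ : ℤ) : ℂ) * ((pair x π : ℤ) : ℂ)) * a π := by
          refine Finset.sum_congr rfl fun π _ => ?_
          rw [Finset.sum_mul]
  -- the inner sums: `[S]` on the diagonal, `0` off it
  have inner : ∀ π ∈ P, ∑ x : S, ((pair x π₀ : ℤ) : ℂ) * ((pair x π : ℤ) : ℂ) =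
      if π = π₀ then (Fintype.card S : ℂ) else 0 := by
    intro π hπ
    split_ifs with hππ
    · subst hππ
      have : ∀ x : S, ((pair x π : ℤ) : ℂ) * ((pair x π : ℤ) : ℂ) = 1 := fun x => by
        rw [← Int.cast_mul, ← Units.val_mul, Int.units_mul_self]; simp
      simp [this]
    · have hψ := sum_signHom_eq_zero (S := S) (fun x => pair x π₀ * pair x π)
        (fun x y => by rw [hmul x y π₀ h₀, hmul x y π hπ]; simp only [mul_assoc, mul_left_comm])
        (by
          by_contra hall
          refine hππ (hsep π hπ π₀ h₀ fun x => ?_)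
          have hx : pair x π₀ * pair x π = 1 := Classical.not_not.mp fun hne => hall ⟨x, hne⟩
          rw [← Int.units_inv_eq_self (pair x π₀), inv_mul_eq_one] at hx
          exact hx.symm)
      simpa [Units.val_mul, Int.cast_mul] using hψ
  rw [step, Finset.sum_congr rfl fun π hπ => by rw [inner π hπ]]
  simp_rw [ite_mul, zero_mul]
  rw [Finset.sum_ite_eq' P π₀, if_pos h₀, ← mul_assoc, inv_mul_cancel₀ hcard, one_mul]

/-- **Ghosts** (COROLLARY 5.2.9 ∕ 5.4.28 from THEOREM 5.2.7 ∕ 5.4.26, pp. 417, 430): a `{±1}`-character `θ` of `S` differing from every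
`⟨·, π⟩`, `π ∈ P`, kills `b`: `Σ_𝔵 θ(𝔵) b_𝔵 = 0` — the printed corollary with the characters as scalars.
[cite: Shelstad1982, Cor. 5.2.9 (p. 417); Cor. 5.4.28 (p. 430)] -/
theorem ghost_of_pairingIdentity (P : Finset ι) (pair : S → ι → ℤˣ)
    (hmul : ∀ x y, ∀ π ∈ P, pair (x * y) π = pair x π * pair y π)
    (θ : S →* ℤˣ) (hθ : ∀ π ∈ P, ∃ x, θ x ≠ pair x π)
    (a : ι → ℂ) (b : S → ℂ) (h : ∀ x, ∑ π ∈ P, ((pair x π : ℤ) : ℂ) * a π = b x) :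
    ∑ x : S, ((θ x : ℤ) : ℂ) * b x = 0 := by
  have step : ∑ x : S, ((θ x : ℤ) : ℂ) * b x =
      ∑ π ∈ P, (∑ x : S, ((θ x : ℤ) : ℂ) * ((pair x π : ℤ) : ℂ)) * a π := by
    calc ∑ x : S, ((θ x : ℤ) : ℂ) * b x
        = ∑ x : S, ∑ π ∈ P, ((θ x : ℤ) : ℂ) * ((pair x π : ℤ) : ℂ) * a π := by
          refine Finset.sum_congr rfl fun x _ => ?_
          rw [← h x, Finset.mul_sum]
          refine Finset.sum_congr rfl fun π _ => ?_
          ring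
      _ = ∑ π ∈ P, ∑ x : S, ((θ x : ℤ) : ℂ) * ((pair x π : ℤ) : ℂ) * a π := Finset.sum_comm
      _ = ∑ π ∈ P, (∑ x : S, ((θ x : ℤ) : ℂ) * ((pair x π : ℤ) : ℂ)) * a π := by
          refine Finset.sum_congr rfl fun π _ => ?_
          rw [Finset.sum_mul]
  rw [step]
  refine Finset.sum_eq_zero fun π hπ => ?_
  have hψ := sum_signHom_eq_zero (S := S) (fun x => θ x * pair x π)
    (fun x y => by rw [map_mul, hmul x y π hπ]; simp only [mul_assoc, mul_left_comm])
    (by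
      obtain ⟨x, hx⟩ := hθ π hπ
      refine ⟨x, fun h1 => hx ?_⟩
      rw [← Int.units_inv_eq_self (θ x), inv_mul_eq_one] at h1
      exact h1)
  have : ∑ x : S, ((θ x : ℤ) : ℂ) * ((pair x π : ℤ) : ℂ) = 0 := by
    simpa [Units.val_mul, Int.cast_mul] using hψ
  rw [this, zero_mul]

end Inversion

namespace PacketPairing

variable {G H : Type u} [Group G] [Group H] {L : LiftingSetting G H} {SS : Type u} [Group SS] [Fintype SS]
  (P : PacketPairing L SS)

/-- **THEOREM 5.4.27 from THEOREM 5.4.26 and LEMMA 5.4.21** («The inversion is immediate», p. 429; p. 417 for 5.2.8 from 5.2.7 and 5.2.6).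
[cite: Shelstad1982, Thm. 5.4.27 (p. 429); Thm. 5.2.8 (p. 417)] -/
theorem Shelstad1982_5_4_27_holds_of_26 (hmul : P.Shelstad1982_5_2_6_i_multiplicative)
    (hsep : P.Shelstad1982_5_2_6_ii_separates) (h26 : P.Shelstad1982_5_4_26_endoscopicCharacterIdentity) :
    P.Shelstad1982_5_4_27_inversion := by
  classical
  intro π₀ h₀ f
  exact inversion_of_pairingIdentity (S := SS) (L.packet P.phi) P.pair hmul
    (fun π hπ π' hπ' hx => (hsep π hπ π' hπ').1 hx) (fun π => L.charOf π f) (fun x => P.chiHat x f)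
    (fun x => h26 x f) π₀ h₀

/-- **COROLLARY 5.4.28 from THEOREM 5.4.26 and LEMMA 5.4.21 (i)** (p. 430; p. 417 for 5.2.9).
[cite: Shelstad1982, Cor. 5.4.28 (p. 430); Cor. 5.2.9 (p. 417)] -/
theorem Shelstad1982_5_4_28_holds_of_26 (hmul : P.Shelstad1982_5_2_6_i_multiplicative)
    (h26 : P.Shelstad1982_5_4_26_endoscopicCharacterIdentity) :
    P.Shelstad1982_5_4_28_ghostVanishing := by
  intro θ hθ f
  exact ghost_of_pairingIdentity (S := SS) (L.packet P.phi) P.pair hmul θ hθ (fun π => L.charOf π f)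
    (fun x => P.chiHat x f) (fun x => h26 x f)

end PacketPairing

end Literature.NumberTheory.Automorphic.Shelstad1982.LPackets
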